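/-
Copyright (c) 2026 the pub-hodgecm-mathlib formalisation cell (harness21).  Prover seat hodgecm-mathlib-K2E5-p04 (g3), HCML Track B «K2-LIT» (build stream 29),
h413 = `stmt-HodgeConjecture-24833`, line `K2_E3_EllipticInputs`, unit U12 «Characters», socket #11 road (11-SC), letter (SC-an), END-GAME MAP v3 (line lead
K2E3-p14 (g3), `K2/STATUS.md` 2026-09-04T02:48:50Z), piece [M6′] «EXPLICIT Bset» (RULINGS #4 (R4-1)), FILE A (MODEL SIDE): for every element of the field model an EXPLICIT radius, with the datum `(t, d, λ, y₀, m_g)` read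
off at split-regular elements (★ [M2a] FILE B (d), ★ (D2a), ★ (D2b), ★ (M5d)).  FILE B `K2E3SupercuspidalTruncatedCharLimCancExplicit` carries it to `(cmDatum L 3 H).Local v`.  2026-09-04.
-/
import Summits.HodgeConjecture.HodgeConjecture.Theorems.K2E3SupercuspidalTruncatedCharLimCanc        -- ★ [M6] p856884 (this seat): §2 shell vanishing at every regular element of the model (both Cartan types); brings ★ [M4], [M5′], [M2a] FILE A∕B, (f2), p856390, p856355
import Summits.HodgeConjecture.HodgeConjecture.Theorems.K2E3SupercuspidalTruncatedCharThm20Radius     -- ★ (M5d) p856849 (K2E3-p14): `setIntegral_sdiff_heightBall_coeff_conj_eq_zero_of_subset` (radius `mC + (1 + 2s + 4mC) + s` READ OFF), `radius_eq`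
import Summits.HodgeConjecture.HodgeConjecture.Theorems.K2E3ConjugatorHeightControlRankOne           -- ★ (D2) p856791 (K2E3-p21): (D2a) `exists_conjugator_mem_heightBall`, (D2b) `mem_heightBall_mul_torusU_of_conj_mem_support`
import Summits.HodgeConjecture.HodgeConjecture.Theorems.F0P3cStCharTSWeylHypFibre                      -- ★ `isUnit_sub_of_isRegularElt_glDiagonal` (regular diagonal ⇒ distinct eigenvalues)
import Literature.NumberTheory.Automorphic.UnitaryThreeTorusDoubleCosetsHK                              -- ★ `exists_v_pow_mul_le_one` (`|ϖ^N x| ≤ 1` for `N ≫ 0`)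
import HarnessLib

/-!
# h413 ∕ Track B «K2-LIT», line `K2_E3_EllipticInputs`, unit U12, road (11-SC), letter (SC-an) — piece [M6′] «EXPLICIT Bset», FILE A (MODEL SIDE): AN EXPLICIT RADIUS
# `5 m_C + 3 s + 1` FOR THE TRUNCATED SUPERCUSPIDAL CHARACTER AT EVERY SPLIT-REGULAR ELEMENT OF `U(σ_w, Φ₃)(L_w)`, WITH ITS DATUM `(t, d, λ, y₀, m_g)`
# (Harish-Chandra 1970, Part VII §3 p. 71 eq. (1), (ii), p. 72; Theorem 20; Cor. of Theorem 18)

Cell `pub/hodgecm-mathlib`, crux H413 = `stmt-HodgeConjecture-24833`, route of record `HCCMUnconditional`; chair K2-lead (g0), dealer K2E3-plan (g2), (SC-an) line lead K2E3-p14 (g3)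
(END-GAME MAP v3 + RULINGS #4 (R4-1), 2026-09-04T02:48:50Z: «[M6′] EXPLICIT Bset … and export the reduction `hball_of_model_bound`»).  THEOREMS ONLY (no `def`, no `instance`,
no `notation`, no named-fact hypothesis, no `sorry`); lane `--supports stmt-HodgeConjecture-24833 --as helper`, count-neutral.

WHY.  ★ [M6] inhabits the `hlim`∕`hcanc` binders of the (SC-an) consumers (★ p856184 ∕ ★ p856355) on `G = (cmDatum L 3 H).Local v` with an OPAQUE radius `R(g)` (★ [M4]'s `∃ R`),
enough for the limit half; but the DOMINATION brick `hball : ∫_{Bset g} ‖θ(x g x⁻¹)‖ ≤ W g` of ★ p856355 must be proved for THE SAME `Bset`, so the radius has to be pinned to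
the (SC-dom) currency.  Along a field model `e : G ≃ₜ* M = U(σ_w, Φ₃)(L_w)` (★ (f2)) with height balls `Ω_M` (★ p856390, given here as INPUT with `hmem` `hinv` `hmul` so that the
(SC-dom) assembler states his model inequality against the same object) THIS FILE chooses, for every `g ∈ G` with `e g` REGULAR and `Z_G(g)` NOT compact, a datum
`t = diag d` (★ [M2a] FILE B (d)), the MINIMAL depth `λ` (`∀ i ≠ k, |ϖ^λ| ≤ |dᵢ − dₖ|`), the MINIMAL height `m_g` (`e g ∈ Ω_M m_g`, Mathlib `CompactExhaustion.find`) and a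
conjugator `y₀ ∈ Ω_M (2m_g + 2λ)` with `e g = y₀ t y₀⁻¹` (★ (D2a)), and sets
  `R(g) := 5·m_C + 3·s + 1`,  `m_C := 2m_θ + 2λ` (★ (D2b): `supp f_t ⊆ Ω_M m_C · T`),  `s := 2m_g + 2λ`,  `Bset g := Ω (R g) = e⁻¹(Ω_M (R g))`,
`m_θ` = a support height of the transported coefficient `θ_M = B u′ (ρ(e⁻¹ ·) u)`; at REGULAR ELLIPTIC `e g` the radius is the compact-support one of ★ [M6] §2, at singular `e g`
(a null set, ★ [M2a] (e)) it is `0`.  With THIS radius: the shell vanishing (★ (M5d) `setIntegral_sdiff_heightBall_coeff_conj_eq_zero_of_subset`), hence `hcanc`∕`hlim` a.e.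
(★ (f1), ★ [M5′] transport, as in ★ [M6]); the datum and its MINIMALITY are EXPORTED (so `m_g`, `λ` are bounded by explicit functions of `g`: any height, resp. ★ (M5e-2)
`v_pow_le_v_sub_of_pow_normAbs_le_token`'s `4τ + 10m`); and `hball`∕`hballE` for `W := W_M ∘ e` are REDUCED to model integrals by the transport identity
`∫_{e⁻¹ S} ‖θ(x g x⁻¹)‖ dμ = ∫_S ‖θ_M(x′ (e g) x′⁻¹)‖ d(e_* μ)` (★ [M5′] `setIntegral_preimage_coeff_conj_eq`).

HONEST LABEL.  HC_CM is proved only modulo the 7 printed citations (2 remaining named inputs: hLiu418 = `stmt-HodgeConjecture-24832`, h413 = `stmt-HodgeConjecture-24833`)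
until rung 0 closes; count-neutral helper: after it the (SC-an) letter at `N = 3` is ★ MODULO the MODEL inequalities behind `hball`, `hballE` ((M5a)(M5b)(M5e-1)(M5f)) and `hW`
((M5g) HC-D-ε), none of which is proved here.

## References
* [HarishChandra1970] Harish-Chandra (notes by G. van Dijk), *Harmonic Analysis on Reductive p-adic Groups*, LNM 162 (1970), Part VII §2 Theorem 20 p. 70, Cor. of Thm 18 p. 69;
  §3 p. 71 eq. (1), (ii), p. 72; Part I §3 Lemma 14 p. 9; Part V Lemma 42.
* [Rogawski1990] J. D. Rogawski, *Automorphic Representations of Unitary Groups in Three Variables*, Ann. of Math. Stud. 123 (1990), §3.1 p. 19, §3.6 pp. 28–31, §4.9 p. 54,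
  §12.2 p. 173, §12.5 p. 182.
* [PlatonovRapinchuk1994] V. Platonov, A. Rapinchuk, *Algebraic Groups and Number Theory* (1994), §5.1.
* [Folland1995] G. B. Folland, *A Course in Abstract Harmonic Analysis* (1995), §2.4.
-/

set_option autoImplicit false
-- the mandated namespace repeats the single-problem summit's segment (`HodgeConjecture.HodgeConjecture`)
set_option linter.dupNamespace false

noncomputable section

open MeasureTheory Measure Set Filter Topology NumberField IsDedekindDomain
open scoped NNReal ENNReal Pointwise Matrix MatrixGroups WithZero
open ValuativeRel
open Literature.NumberTheory.Automorphic Literature.NumberTheory.Automorphic.UnitaryGroup Literature.NumberTheory.Rogawski1990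
open Literature.NumberTheory.GaloisRepresentations

namespace Summit.HodgeConjecture.HodgeConjecture.Cruxes.H413.K2E3SupercuspidalTruncatedCharRadiusDatum

/-! ## §1 The model `M = U(σ_w, Φ₃)(L_w)`: a radius for every element, with the datum read off at split-regular elements -/

section Model

variable (L : Type) [Field L] [NumberField L] [IsCMField L] {v : HeightOneSpectrum (𝓞 ↥(maximalRealSubfield L))}
  (w : PlacesOver L v) (hw : IsCMField.complexConj L • w.1 = w.1)

omit [NumberField L] [IsCMField L] in
/-- **A REGULAR DIAGONAL ELEMENT HAS A DEPTH**: for `t = diag d` regular (distinct eigenvalues, ★ `isUnit_sub_of_isRegularElt_glDiagonal`) and `|ϖ| = exp(−1)` there is `λ` with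
`|ϖ^λ| ≤ |dᵢ − dₖ|` for all `i ≠ k` (★ `exists_v_pow_mul_le_one` on the three inverse differences). [cite: HarishChandra1970, Part VII §2 p. 69] [cite: Rogawski1990, §3.1 p. 19] -/
theorem exists_depth_of_isRegularElt {K : Type*} [Field K] [Valued K ℤᵐ⁰] {ϖ : K} (hϖ : Valued.v ϖ = WithZero.exp (-1 : ℤ))
    {d : Fin 3 → Kˣ} (hreg : IsRegularElt (glDiagonal 3 K d)) :
    ∃ lam : ℕ, ∀ i k : Fin 3, i ≠ k → Valued.v (ϖ ^ lam) ≤ Valued.v ((d i : K) - d k) := by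
  -- one exponent per ordered pair, then the maximum
  have hpair : ∀ i k : Fin 3, i ≠ k → ∃ N : ℕ, ∀ M : ℕ, N ≤ M → Valued.v (ϖ ^ M) ≤ Valued.v ((d i : K) - d k) := by
    intro i k hik
    have hne : ((d i : K) - d k) ≠ 0 := (F0P3cStCharTSWeylHypFibre.isUnit_sub_of_isRegularElt_glDiagonal hreg hik).ne_zero
    obtain ⟨N, hN⟩ := exists_v_pow_mul_le_one hϖ (((d i : K) - d k)⁻¹)
    refine ⟨N, fun M hM => ?_⟩
    have h := hN M hM
    rw [map_mul, map_inv₀] at h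
    have hv0 : Valued.v ((d i : K) - d k) ≠ 0 := (Valuation.ne_zero_iff _).2 hne
    rwa [mul_inv_le_iff₀ (pos_iff_ne_zero.2 hv0), one_mul] at h
  choose N hN using hpair
  refine ⟨Finset.univ.sup fun p : Fin 3 × Fin 3 => if h : p.1 ≠ p.2 then N p.1 p.2 h else 0, fun i k hik => hN i k hik _ ?_⟩
  have h1 : (if h : (i, k).1 ≠ (i, k).2 then N (i, k).1 (i, k).2 h else 0) = N i k hik := dif_pos hik
  rw [← h1]
  exact Finset.le_sup (f := fun p : Fin 3 × Fin 3 => if h : p.1 ≠ p.2 then N p.1 p.2 h else 0) (Finset.mem_univ (i, k))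

open scoped Classical in
/-- **A RADIUS FOR EVERY ELEMENT OF THE MODEL, WITH THE DATUM READ OFF AT SPLIT-REGULAR ELEMENTS.**  `M = U(σ_w, J)(L_w)`, `J = Φ₃`; `Ω` the height-ball exhaustion (★ p856390's
`hmem` `hinv` `hmul`); `θ_M = B u′ (ρ(·) u)` a coefficient of a smooth SUPERCUSPIDAL `ρ` of `M` (`B` invariant) supported in `Ω m_θ`; `μ` a Haar measure.  For every `m ∈ M` there is ONE
radius `R` such that (i) if `m` is regular, `∫_{Ω n ∖ Ω R} θ_M(x m x⁻¹) dμ = 0` for every `n`; (ii) if `m` is regular with NON-compact centraliser, `R = 5(2m_θ + 2λ) + 3(2m_g + 2λ) + 1`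
for a DATUM `(t, d, y₀, λ, m_g)`: `t = diag d` regular, `λ` the MINIMAL depth of `t`, `m_g` the MINIMAL height of `m` (`m ∈ Ω m_g`), `y₀ ∈ Ω (2m_g + 2λ)`, `m = y₀ t y₀⁻¹`.  Split type: ★
[M2a] FILE B (d) (Cartan), ★ (D2a) (conjugator control), ★ (D2b) (support `⊆ Ω (2m_θ + 2λ) · T`), ★ (M5d) (Theorem 20 with explicit radius); elliptic type: ★ [M6] §2 (compact support);
singular: `R := 0`. [cite: HarishChandra1970, Part VII §2 Theorem 20 p. 70, Cor. of Thm 18 p. 69; §3 p. 71 eq. (1), (ii); Part I §3 Lemma 14 p. 9]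
[cite: Rogawski1990, §3.6 pp. 28–31, §4.9 p. 54, §12.2 p. 173] -/
theorem exists_radius_and_datum {J : Matrix (Fin 3) (Fin 3) (w.1.adicCompletion L)}
    (hJ : J = (StdForm.antidiagonal 3).over (w.1.adicCompletion L))
    [MeasurableSpace ↥(unitaryGroupOfForm (galAdicCompletionMap (L := L) (IsCMField.complexConj L) hw) J)]
    [BorelSpace ↥(unitaryGroupOfForm (galAdicCompletionMap (L := L) (IsCMField.complexConj L) hw) J)]
    (μ : Measure ↥(unitaryGroupOfForm (galAdicCompletionMap (L := L) (IsCMField.complexConj L) hw) J)) [μ.IsHaarMeasure]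
    (Ω : CompactExhaustion ↥(unitaryGroupOfForm (galAdicCompletionMap (L := L) (IsCMField.complexConj L) hw) J)) {ϖ : w.1.adicCompletion L}
    (hϖ : Valued.v ϖ = WithZero.exp (-1 : ℤ))
    (hmem : ∀ (m : ℕ) (g : ↥(unitaryGroupOfForm (galAdicCompletionMap (L := L) (IsCMField.complexConj L) hw) J)), g ∈ Ω m ↔
      (∀ i j, Valued.v (ϖ ^ m * ((g : GL (Fin 3) (w.1.adicCompletion L)) : Matrix (Fin 3) (Fin 3) (w.1.adicCompletion L)) i j) ≤ 1) ∧
        ∀ i j, Valued.v (ϖ ^ m * (((g : GL (Fin 3) (w.1.adicCompletion L))⁻¹ : GL (Fin 3) (w.1.adicCompletion L)) :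
          Matrix (Fin 3) (Fin 3) (w.1.adicCompletion L)) i j) ≤ 1)
    (hinv : ∀ (m : ℕ) (g : ↥(unitaryGroupOfForm (galAdicCompletionMap (L := L) (IsCMField.complexConj L) hw) J)), g ∈ Ω m → g⁻¹ ∈ Ω m)
    (hmul : ∀ (a b : ℕ) (g h : ↥(unitaryGroupOfForm (galAdicCompletionMap (L := L) (IsCMField.complexConj L) hw) J)), g ∈ Ω a → h ∈ Ω b → g * h ∈ Ω (a + b))
    {V : Type*} [AddCommGroup V] [Module ℂ V]
    (ρ : Representation ℂ ↥(unitaryGroupOfForm (galAdicCompletionMap (L := L) (IsCMField.complexConj L) hw) J) V) (hsm : ρ.IsSmooth) (hsc : ρ.IsSupercuspidal)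
    (B : V →ₗ⋆[ℂ] V →ₗ[ℂ] ℂ)
    (hBinv : ∀ (g : ↥(unitaryGroupOfForm (galAdicCompletionMap (L := L) (IsCMField.complexConj L) hw) J)) (x y : V), B (ρ g x) (ρ g y) = B x y) (u u' : V)
    {mθ : ℕ} (hθ : ∀ g : ↥(unitaryGroupOfForm (galAdicCompletionMap (L := L) (IsCMField.complexConj L) hw) J), B u' (ρ g u) ≠ 0 → g ∈ Ω mθ)
    (m : ↥(unitaryGroupOfForm (galAdicCompletionMap (L := L) (IsCMField.complexConj L) hw) J)) :
    ∃ R : ℕ,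
      (IsRegularElt (m : GL (Fin 3) (w.1.adicCompletion L)) → ∀ n : ℕ, ∫ x in Ω n \ Ω R, B u' (ρ (x * m * x⁻¹) u) ∂μ = 0) ∧
      (IsRegularElt (m : GL (Fin 3) (w.1.adicCompletion L)) →
        ¬ IsCompact ((Subgroup.centralizer ({m} : Set ↥(unitaryGroupOfForm (galAdicCompletionMap (L := L) (IsCMField.complexConj L) hw) J)) :
          Subgroup ↥(unitaryGroupOfForm (galAdicCompletionMap (L := L) (IsCMField.complexConj L) hw) J)) :
            Set ↥(unitaryGroupOfForm (galAdicCompletionMap (L := L) (IsCMField.complexConj L) hw) J)) →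
        ∃ (t y₀ : ↥(unitaryGroupOfForm (galAdicCompletionMap (L := L) (IsCMField.complexConj L) hw) J)) (d : Fin 3 → (w.1.adicCompletion L)ˣ) (lam mg : ℕ),
          glDiagonal 3 (w.1.adicCompletion L) d = (t : GL (Fin 3) (w.1.adicCompletion L)) ∧ IsRegularElt (t : GL (Fin 3) (w.1.adicCompletion L)) ∧
          (∀ i k : Fin 3, i ≠ k → Valued.v (ϖ ^ lam) ≤ Valued.v ((d i : w.1.adicCompletion L) - d k)) ∧
          (∀ lam' : ℕ, (∀ i k : Fin 3, i ≠ k → Valued.v (ϖ ^ lam') ≤ Valued.v ((d i : w.1.adicCompletion L) - d k)) → lam ≤ lam') ∧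
          m ∈ Ω mg ∧ (∀ m' : ℕ, m ∈ Ω m' → mg ≤ m') ∧
          y₀ ∈ Ω (2 * mg + 2 * lam) ∧ m = y₀ * t * y₀⁻¹ ∧
          R = 5 * (2 * mθ + 2 * lam) + 3 * (2 * mg + 2 * lam) + 1) := by
  by_cases hreg : IsRegularElt (m : GL (Fin 3) (w.1.adicCompletion L))
  swap
  · exact ⟨0, fun h => absurd h hreg, fun h => absurd h hreg⟩
  by_cases hZ : IsCompact ((Subgroup.centralizer ({m} : Set ↥(unitaryGroupOfForm (galAdicCompletionMap (L := L) (IsCMField.complexConj L) hw) J)) :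
      Subgroup ↥(unitaryGroupOfForm (galAdicCompletionMap (L := L) (IsCMField.complexConj L) hw) J)) :
        Set ↥(unitaryGroupOfForm (galAdicCompletionMap (L := L) (IsCMField.complexConj L) hw) J))
  · -- ELLIPTIC: the compact-support radius of ★ [M6] §2; no datum owed
    obtain ⟨R, hR⟩ := K2E3SupercuspidalTruncatedCharLimCanc.exists_forall_setIntegral_sdiff_coeff_conj_eq_zero_of_isRegularElt L w hw hJ μ Ω hϖ hmem hinv hmul
      ρ hsm hsc B hBinv u u' m hreg
    exact ⟨R, fun _ => hR, fun _ h => absurd hZ h⟩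
  · -- SPLIT: the datum
    -- frame of `L_w` and `M` (★ [M2a] FILE A; ★ `AdicCompletionLocalField` instances)
    letI : MeasurableSpace (w.1.adicCompletion L) := borel _
    haveI : BorelSpace (w.1.adicCompletion L) := ⟨rfl⟩
    haveI : SecondCountableTopology (w.1.adicCompletion L) := secondCountableTopology_adicCompletion L w.1
    haveI : CharZero (w.1.adicCompletion L) := charZero_of_injective_algebraMap (algebraMap L (w.1.adicCompletion L)).injective
    haveI : SecondCountableTopology (GL (Fin 3) (w.1.adicCompletion L)) := secondCountableTopology_gl_adicCompletion L 3 w.1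
    haveI : SecondCountableTopology ↥(unitaryGroupOfForm (galAdicCompletionMap (L := L) (IsCMField.complexConj L) hw) J) :=
      K2E3SupercuspModelFrameAtPlace.secondCountableTopology_unitaryGroupOfForm_adicCompletion L w _ J
    haveI : LocallyCompactSpace ↥(unitaryGroupOfForm (galAdicCompletionMap (L := L) (IsCMField.complexConj L) hw) J) :=
      K2E3SupercuspModelFrameAtPlace.locallyCompactSpace_unitaryGroupOfForm_adicCompletion L w hw J
    haveI : μ.IsMulRightInvariant := K2E3SupercuspModelFrameAtPlace.isMulRightInvariant_of_isHaarMeasure_of_eq_over L w hw hJ μ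
    have hσσ : ∀ x, galAdicCompletionMap (L := L) (IsCMField.complexConj L) hw (galAdicCompletionMap (L := L) (IsCMField.complexConj L) hw x) = x :=
      galAdicCompletionMap_galAdicCompletionMap_of_smul_eq (IsCMField.complexConj L) w (IsCMField.complexConj_ne_one L) hw
    have hσc : Continuous (galAdicCompletionMap (L := L) (IsCMField.complexConj L) hw) := continuous_galAdicCompletionMap L (IsCMField.complexConj L) hw
    have hσv : ∀ x, Valued.v (galAdicCompletionMap (L := L) (IsCMField.complexConj L) hw x) = Valued.v x :=
      fun x => valued_galAdicCompletionMap (L := L) (IsCMField.complexConj L) hw x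
    have hZc := K2E3SupercuspModelFrameAtPlace.isCompact_center_of_eq_over L w hw hJ
    have hZs := K2E3SupercuspModelFrameAtPlace.exists_coe_eq_scalar_of_mem_center L w hw hJ
    obtain ⟨ϖ', hϖ'0, hϖ'1, hσϖ'⟩ := K2E3SupercuspModelFrameAtPlace.exists_ne_zero_valuation_lt_one_map_eq L w hw
    -- the Cartan datum `m = y t y⁻¹` (★ FILE B (d))
    obtain ⟨y, t, d, hd, htreg, hmy, -⟩ := K2E3SupercuspModelFrameAtPlaceCartan.exists_conj_torusU_of_not_isCompact_centralizer L w hw hJ hreg hZ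
    have hreg' : IsRegularElt (glDiagonal 3 (w.1.adicCompletion L) d) := by rw [hd]; exact htreg
    -- the MINIMAL depth `λ` and the MINIMAL height `m_g`
    have hex := exists_depth_of_isRegularElt hϖ hreg'
    set lam : ℕ := Nat.find hex with hlam
    have hlam_spec : ∀ i k : Fin 3, i ≠ k → Valued.v (ϖ ^ lam) ≤ Valued.v ((d i : w.1.adicCompletion L) - d k) := Nat.find_spec hex
    have hlam_min : ∀ lam' : ℕ, (∀ i k : Fin 3, i ≠ k → Valued.v (ϖ ^ lam') ≤ Valued.v ((d i : w.1.adicCompletion L) - d k)) → lam ≤ lam' :=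
      fun lam' h => Nat.find_min' hex h
    set mg : ℕ := Ω.find m with hmg
    have hmg_mem : m ∈ Ω mg := Ω.mem_find m
    have hmg_min : ∀ m' : ℕ, m ∈ Ω m' → mg ≤ m' := fun m' h => Ω.mem_iff_find_le.1 h
    -- the conjugator of controlled height (★ (D2a)) and the support datum (★ (D2b))
    obtain ⟨y₀, hy₀, hmy₀⟩ := K2E3ConjugatorHeightControlRankOne.exists_conjugator_mem_heightBall (galAdicCompletionMap (L := L) (IsCMField.complexConj L) hw)
      hσv hσσ hJ hϖ Ω hmem hd hlam_spec hmg_mem hmy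
    have hsupp := K2E3ConjugatorHeightControlRankOne.mem_heightBall_mul_torusU_of_conj_mem_support (galAdicCompletionMap (L := L) (IsCMField.complexConj L) hw)
      hσv hσσ hJ hϖ Ω hmem (fun g => B u' (ρ g u)) hθ hd hlam_spec
    -- Theorem 20 with the explicit radius (★ (M5d))
    refine ⟨(2 * mθ + 2 * lam) + (1 + 2 * (2 * mg + 2 * lam) + 4 * (2 * mθ + 2 * lam)) + (2 * mg + 2 * lam), fun _ n => ?_, fun _ _ => ?_⟩
    · rw [hmy₀]
      exact K2E3SupercuspidalTruncatedCharThm20Radius.setIntegral_sdiff_heightBall_coeff_conj_eq_zero_of_subset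
        (galAdicCompletionMap (L := L) (IsCMField.complexConj L) hw) hσσ hσc hσv two_ne_zero hJ μ hϖ hϖ'0 hϖ'1 hσϖ' hZs hZc Ω hmem hinv hmul ρ hsm hsc B hBinv u u'
        t hd htreg (Ω (2 * mθ + 2 * lam)) subset_rfl hsupp hy₀ n
    · exact ⟨t, y₀, d, lam, mg, hd, htreg, hlam_spec, hlam_min, hmg_mem, hmg_min, hy₀, hmy₀,
        K2E3SupercuspidalTruncatedCharThm20Radius.radius_eq _ _⟩

end Model

end Summit.HodgeConjecture.HodgeConjecture.Cruxes.H413.K2E3SupercuspidalTruncatedCharRadiusDatum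

end
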